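import Mathlib.Combinatorics.Enumerative.DoubleCounting
import Literature.Computability.AlgebraicComplexity.DM16NonCommutativeRank

/-!
# `ncrk 𝒳(p, 2p+1) = C(2p+1, p)` for every `p` — discharge of [DM16, Thm 1.15] and of the
# [EGOW18, §6] statement; [EGOW18, Conj 6.1] at `d = 1` unconditionally

Sources: [DM16] H. Derksen, V. Makam, *On non-commutative rank and tensor rank*, LMA 66 (2018) =
arXiv:1606.06701, Thm 1.15 (p. 4), Cor 4.7 (p. 9); [EGOW18] Efremenko–Garg–Oliveira–Wigderson,
ITCS 2018 = arXiv:1710.09502, §6 p. 17 (bullet 4 and Conj 6.1). Statements and vocabulary: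
`Literature/Computability/AlgebraicComplexity/NonCommutativeRank.lean` (`ncRank`, `imageSubspace`,
`shrunkCost`) and `…/DM16NonCommutativeRank.lean` (`extMulMatrix`, `dmSpace`, the named facts
`DerksenMakam2018_thm_1_15`, `EGOW2018_sec6_derksenMakam`).

THE PROOF HERE IS NOT THE PRINTED ONE. [DM16, §4] deduces full non-commutative rank of
`A(p, 2p+1)` from the invertibility of Landsberg's explicit Toeplitz blow-up ([DM16, Prop 4.6] =
[Landsberg2015], kept as the named fact `DerksenMakam2018_prop_4_6`, untouched). We prove
`ncrk 𝒳(p,2p+1) = C(2p+1,p)` directly in the shrunk-subspace form, over every field with an element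
`a ∉ {0, 1}` (so every field except `𝔽₂`; in particular characteristic `0`, the setting of [DM16, §4]):
1. (lattice) optimal shrunk subspaces are closed under `⊔` (submodularity of
   `V ↦ codim V + dim 𝓑V`), so there is a GREATEST optimal subspace `V*` (general `𝓑`, proved here:
   `imageSubspace_sup`, `shrunkCost_sup_add_inf_le`, `exists_greatest_optimal`);
2. (symmetry) the diagonal torus acts: scaling `e_S ↦ a^{[s ∈ S]} e_S` on `Λ^p` and `Λ^{p+1}`
   conjugates `L_{e_i}` to `a^{[i = s]} L_{e_i}`, so it maps optimal subspaces to optimal subspaces,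
   hence fixes `V*` (`map_le_of_greatest_optimal`, `imageSubspace_map_scale_le`);
3. (weights) a torus-stable subspace is spanned by the basis vectors `e_S` it contains (`a ≠ 0, 1`;
   `single_apply_mem_of_scale_stable`);
4. (Hall) for a family `𝒮` of `p`-subsets of `[2p+1]`, the upper shadow `∇𝒮` has `|∇𝒮| ≥ |𝒮|`
   (the inclusion graph between `p`- and `(p+1)`-subsets is `(p+1)`-regular on both sides;
   `card_le_card_upperShadow`), and `𝒳 · span{e_S : S ∈ 𝒮} ⊇ {e_T : T ∈ ∇𝒮}`; hence
   `dim 𝒳V* ≥ dim V*`, i.e. the cost of `V*` is `≥ C(2p+1,p)`: no shrinkage.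
Consequences (PROVED, no named fact used): `ncRank_dmSpace_eq_choose` ([DM16, Cor 4.7] for all
fields `≠ 𝔽₂`), `DerksenMakam2018_thm_1_15_holds` (discharge), `EGOW2018_sec6_derksenMakam_of_charZero`,
and `EGOW2018_conj61_degOne`: **[EGOW18, Conjecture 6.1] holds at `d = 1` over every field of
characteristic `0`**, unconditionally. Honest framing: a statement about ranks of linear matrices;
nothing here bears on `VP ≠ VNP`.
-/

open MvPolynomial

namespace Literature.Computability.AlgebraicComplexity

/-! ## 1. The lattice of optimal shrunk subspaces (general matrix spaces) -/

section Lattice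

variable {F : Type*} [Field F] {ι κ : Type*} [Fintype κ]

/-- `𝓑(V ⊔ W) = 𝓑(V) ⊔ 𝓑(W)`. [cite: BlaeserJindalPandey2018, Def 2.3, p. 5] locator: paper:doi-10-4086-toc-2018-v014a003 p0005.txt:L13 -/
theorem imageSubspace_sup (𝓑 : Set (Matrix ι κ F)) (V W : Submodule F (κ → F)) :
    imageSubspace 𝓑 (V ⊔ W) = imageSubspace 𝓑 V ⊔ imageSubspace 𝓑 W := by
  refine le_antisymm ?_ (sup_le (imageSubspace_mono le_rfl le_sup_left)
    (imageSubspace_mono le_rfl le_sup_right))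
  refine Submodule.span_le.2 ?_
  rintro _ ⟨B, hB, u, hu, rfl⟩
  obtain ⟨v, hv, w, hw, rfl⟩ := Submodule.mem_sup.1 hu
  rw [Matrix.mulVec_add]
  exact Submodule.add_mem_sup (Submodule.subset_span ⟨B, hB, v, hv, rfl⟩)
    (Submodule.subset_span ⟨B, hB, w, hw, rfl⟩)

variable [Fintype ι]

/-- **Submodularity of the cost**: `cost(V ⊔ W) + cost(V ⊓ W) ≤ cost V + cost W` for
`cost V = codim V + dim 𝓑V`. [cite: IvanyosQiaoSubrahmanyam2018, §1, p. 3] locator: paper:arxiv-1512.03531 p0003.txt:L60 -/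
theorem shrunkCost_sup_add_inf_le (𝓑 : Set (Matrix ι κ F)) (V W : Submodule F (κ → F)) :
    shrunkCost 𝓑 (V ⊔ W) + shrunkCost 𝓑 (V ⊓ W) ≤ shrunkCost 𝓑 V + shrunkCost 𝓑 W := by
  have h1 := Submodule.finrank_quotient_add_finrank (V ⊔ W)
  have h2 := Submodule.finrank_quotient_add_finrank (V ⊓ W)
  have h3 := Submodule.finrank_quotient_add_finrank V
  have h4 := Submodule.finrank_quotient_add_finrank W
  have h5 := Submodule.finrank_sup_add_finrank_inf_eq V W
  have h6 := Submodule.finrank_sup_add_finrank_inf_eq (imageSubspace 𝓑 V) (imageSubspace 𝓑 W)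
  have h7 : Module.finrank F (imageSubspace 𝓑 (V ⊓ W)) ≤
      Module.finrank F ↥(imageSubspace 𝓑 V ⊓ imageSubspace 𝓑 W) :=
    Submodule.finrank_mono (le_inf (imageSubspace_mono le_rfl inf_le_left)
      (imageSubspace_mono le_rfl inf_le_right))
  unfold shrunkCost
  rw [imageSubspace_sup]
  omega

/-- **Optimal shrunk subspaces are closed under `⊔`.** [cite: IvanyosQiaoSubrahmanyam2018, §1, p. 3] locator: paper:arxiv-1512.03531 p0003.txt:L60 -/
theorem shrunkCost_sup_eq_ncRank {𝓑 : Set (Matrix ι κ F)} {V W : Submodule F (κ → F)}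
    (hV : shrunkCost 𝓑 V = ncRank 𝓑) (hW : shrunkCost 𝓑 W = ncRank 𝓑) :
    shrunkCost 𝓑 (V ⊔ W) = ncRank 𝓑 := by
  have h1 := shrunkCost_sup_add_inf_le 𝓑 V W
  have h2 := ncRank_le_shrunkCost 𝓑 (V ⊓ W)
  have h3 := ncRank_le_shrunkCost 𝓑 (V ⊔ W)
  omega

/-- **The greatest optimal shrunk subspace** (the optimal subspace of largest dimension contains
every optimal subspace). [cite: IvanyosQiaoSubrahmanyam2018, §1, p. 3] locator: paper:arxiv-1512.03531 p0003.txt:L60 -/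
theorem exists_greatest_optimal (𝓑 : Set (Matrix ι κ F)) :
    ∃ V : Submodule F (κ → F), shrunkCost 𝓑 V = ncRank 𝓑 ∧
      ∀ W : Submodule F (κ → F), shrunkCost 𝓑 W = ncRank 𝓑 → W ≤ V := by
  let s : Set ℕ := {d | ∃ V : Submodule F (κ → F), shrunkCost 𝓑 V = ncRank 𝓑 ∧ Module.finrank F V = d}
  have hne : s.Nonempty := by
    obtain ⟨V, hV⟩ := exists_shrunkCost_eq_ncRank 𝓑
    exact ⟨_, V, hV, rfl⟩
  have hbdd : BddAbove s := ⟨Fintype.card κ, by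
    rintro _ ⟨V, -, rfl⟩
    exact (Submodule.finrank_le V).trans (Module.finrank_fintype_fun_eq_card F).le⟩
  obtain ⟨V, hV, hVd⟩ := Nat.sSup_mem hne hbdd
  refine ⟨V, hV, fun W hW => ?_⟩
  have hsup := shrunkCost_sup_eq_ncRank hV hW
  have hle : Module.finrank F ↥(V ⊔ W) ≤ Module.finrank F V := by
    rw [hVd]
    exact le_csSup hbdd ⟨V ⊔ W, hsup, rfl⟩
  have heq : V = V ⊔ W :=
    Submodule.eq_of_le_of_finrank_eq le_sup_left
      (le_antisymm (Submodule.finrank_mono le_sup_left) hle)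
  exact heq ▸ le_sup_right

/-- **Symmetries preserve the greatest optimal subspace**: if injective linear maps `Q` (columns)
and `P` (rows) satisfy `𝓑(Q V) ⊆ P(𝓑 V)` for the greatest optimal `V`, then `Q V ⊆ V`.
[cite: IvanyosQiaoSubrahmanyam2018, §1, p. 3] locator: paper:arxiv-1512.03531 p0003.txt:L60 -/
theorem map_le_of_greatest_optimal {𝓑 : Set (Matrix ι κ F)} {V : Submodule F (κ → F)}
    (hV : shrunkCost 𝓑 V = ncRank 𝓑)
    (hmax : ∀ W : Submodule F (κ → F), shrunkCost 𝓑 W = ncRank 𝓑 → W ≤ V)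
    (Q : (κ → F) →ₗ[F] (κ → F)) (hQ : Function.Injective Q) (P : (ι → F) →ₗ[F] (ι → F))
    (hP : Function.Injective P)
    (h : imageSubspace 𝓑 (V.map Q) ≤ (imageSubspace 𝓑 V).map P) : V.map Q ≤ V := by
  refine hmax _ (le_antisymm ?_ (ncRank_le_shrunkCost _ _))
  rw [← hV, shrunkCost, shrunkCost]
  have h1 := Submodule.finrank_quotient_add_finrank (V.map Q)
  have h2 := Submodule.finrank_quotient_add_finrank V
  have h3 : Module.finrank F (V.map Q) = Module.finrank F V :=
    (Submodule.equivMapOfInjective Q hQ V).finrank_eq.symm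
  have h4 : Module.finrank F (imageSubspace 𝓑 (V.map Q)) ≤ Module.finrank F (imageSubspace 𝓑 V) :=
    (Submodule.finrank_mono h).trans
      (Submodule.equivMapOfInjective P hP _).finrank_eq.symm.le
  omega

end Lattice

/-! ## 2. The torus symmetry of `𝒳(p,n)` and torus-stable subspaces -/

section Torus

variable {K : Type*} [Field K] {n p : ℕ}

/-- A diagonal matrix with non-zero entries acts injectively.
[cite: DerksenMakam2018, §4, p. 9] locator: paper:arxiv-1606.06701 p0009.txt:L3 -/
theorem mulVecLin_diagonal_injective {X : Type*} [Fintype X] [DecidableEq X] {d : X → K}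
    (hd : ∀ x, d x ≠ 0) : Function.Injective (Matrix.diagonal d).mulVecLin := by
  intro v w h
  funext x
  have := congr_fun h x
  simp only [Matrix.mulVecLin_apply, Matrix.mulVec_diagonal] at this
  exact mul_left_cancel₀ (hd x) this

/-- **Torus equivariance of `L_{e_i}`**: scaling `e_S ↦ a^{[s ∈ S]} e_S` on `Λ^p` and `Λ^{p+1}`
conjugates `L_{e_i}` into `a^{[i = s]} · L_{e_i}` (the weight of `e_i` under the `s`-th coordinate
torus). [cite: DerksenMakam2018, §4, p. 9] locator: paper:arxiv-1606.06701 p0009.txt:L5 -/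
theorem extMulMatrix_mulVec_scale (s i : Fin n) {a : K} (ha : a ≠ 0) (w : ExtIdx n p → K) :
    (extMulMatrix K n p i).mulVec
        ((Matrix.diagonal fun S : ExtIdx n p => if s ∈ S.1 then a else (1 : K)).mulVec w) =
      (if i = s then a⁻¹ else 1) •
        (Matrix.diagonal fun T : ExtIdx n (p + 1) => if s ∈ T.1 then a else (1 : K)).mulVec
          ((extMulMatrix K n p i).mulVec w) := by
  classical
  have hd : (Matrix.diagonal fun S : ExtIdx n p => if s ∈ S.1 then a else (1 : K)).mulVec w =
      fun S => (if s ∈ S.1 then a else 1) * w S :=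
    funext fun S => Matrix.mulVec_diagonal _ _ S
  rw [hd]
  funext T
  simp only [Pi.smul_apply, smul_eq_mul, Matrix.mulVec_diagonal]
  simp only [Matrix.mulVec, dotProduct, extMulMatrix, Matrix.of_apply, Finset.mul_sum]
  refine Finset.sum_congr rfl fun S _ => ?_
  by_cases hT : T.1 = insert i S.1
  · have hi : i ∉ S.1 := fun hi => by
      have := T.2
      rw [hT, Finset.insert_eq_of_mem hi, S.2] at this
      omega
    have hsT : s ∈ T.1 ↔ s = i ∨ s ∈ S.1 := by rw [hT, Finset.mem_insert]
    rw [if_pos hT]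
    by_cases his : i = s
    · subst his
      have h1 : i ∈ T.1 := hsT.2 (Or.inl rfl)
      simp only [if_true, if_neg hi, if_pos h1]
      field_simp
    · rw [if_neg his, one_mul]
      by_cases h2 : s ∈ S.1
      · rw [if_pos h2, if_pos (hsT.2 (Or.inr h2))]
        ring
      · have h3 : s ∉ T.1 := fun h3 => by
          rcases hsT.1 h3 with h4 | h4
          · exact his h4.symm
          · exact h2 h4
        rw [if_neg h2, if_neg h3]
        ring
  · rw [if_neg hT]
    simp

/-- The torus maps `𝒳(p,n)`-images to images: `𝒳 (D_p V) ⊆ D_{p+1} (𝒳 V)`.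
[cite: DerksenMakam2018, §4, p. 9] locator: paper:arxiv-1606.06701 p0009.txt:L5 -/
theorem imageSubspace_map_scale_le (s : Fin n) {a : K} (ha : a ≠ 0)
    (V : Submodule K (ExtIdx n p → K)) :
    imageSubspace (Set.range (extMulMatrix K n p))
        (V.map (Matrix.diagonal fun S : ExtIdx n p => if s ∈ S.1 then a else (1 : K)).mulVecLin) ≤
      (imageSubspace (Set.range (extMulMatrix K n p)) V).map
        (Matrix.diagonal fun T : ExtIdx n (p + 1) => if s ∈ T.1 then a else (1 : K)).mulVecLin := by
  refine Submodule.span_le.2 ?_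
  rintro _ ⟨_, ⟨i, rfl⟩, _, ⟨v, hv, rfl⟩, rfl⟩
  rw [Matrix.mulVecLin_apply, extMulMatrix_mulVec_scale s i ha v]
  refine ⟨(if i = s then a⁻¹ else 1) • (extMulMatrix K n p i).mulVec v,
    Submodule.smul_mem _ _ (map_mulVecLin_le_imageSubspace (𝓑 := Set.range (extMulMatrix K n p))
      (B := extMulMatrix K n p i) ⟨i, rfl⟩ V ⟨v, hv, rfl⟩), ?_⟩
  rw [map_smul, Matrix.mulVecLin_apply]

/-- **Weight-space decomposition**: a subspace of `Λ^p` stable under the coordinate torus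
(`e_S ↦ a^{[s ∈ S]} e_S` for every `s`, one fixed `a ∉ {0,1}`... only `a ≠ 1` is used here) contains,
with every vector `w`, each of its coordinate components `w_S e_S`.
[cite: DerksenMakam2018, §4, p. 9] locator: paper:arxiv-1606.06701 p0009.txt:L3 -/
theorem single_apply_mem_of_scale_stable {V : Submodule K (ExtIdx n p → K)} {a : K} (ha1 : a ≠ 1)
    (hV : ∀ (s : Fin n), ∀ w ∈ V,
      (Matrix.diagonal fun S : ExtIdx n p => if s ∈ S.1 then a else (1 : K)).mulVec w ∈ V)
    {w : ExtIdx n p → K} (hw : w ∈ V) (S₀ : ExtIdx n p) : Pi.single S₀ (w S₀) ∈ V := by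
  classical
  suffices key : ∀ A : Finset (Fin n),
      (fun S : ExtIdx n p => if (∀ s ∈ A, s ∈ S.1 ↔ s ∈ S₀.1) then w S else 0) ∈ V by
    have h := key Finset.univ
    convert h using 1
    funext S
    by_cases hS : S = S₀
    · subst hS
      simp
    · rw [Pi.single_eq_of_ne hS, if_neg]
      intro hall
      exact hS (Subtype.ext (Finset.ext fun s => hall s (Finset.mem_univ _)))
  intro A
  induction A using Finset.induction_on with
  | empty =>
    have : (fun S : ExtIdx n p => if (∀ s ∈ (∅ : Finset (Fin n)), s ∈ S.1 ↔ s ∈ S₀.1)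
        then w S else 0) = w := by
      funext S
      simp
    rw [this]
    exact hw
  | insert s A hsA ih =>
    have ha1' : a - 1 ≠ 0 := sub_ne_zero.2 ha1
    set u : ExtIdx n p → K :=
      fun S => if (∀ t ∈ A, t ∈ S.1 ↔ t ∈ S₀.1) then w S else 0 with hu
    have hσ := hV s u ih
    have hπ : (fun S : ExtIdx n p => if s ∈ S.1 then u S else 0) ∈ V := by
      have hmem : (a - 1)⁻¹ •
          ((Matrix.diagonal fun S : ExtIdx n p => if s ∈ S.1 then a else (1 : K)).mulVec u - u) ∈ V :=
        V.smul_mem _ (V.sub_mem hσ ih)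
      convert hmem using 1
      funext S
      simp only [Pi.smul_apply, Pi.sub_apply, Matrix.mulVec_diagonal, smul_eq_mul]
      split_ifs
      · field_simp
      · ring
    have hπ' : (fun S : ExtIdx n p => if s ∈ S.1 then 0 else u S) ∈ V := by
      have hmem := V.sub_mem ih hπ
      convert hmem using 1
      funext S
      simp only [Pi.sub_apply]
      split_ifs <;> ring
    by_cases hs0 : s ∈ S₀.1
    · convert hπ using 1
      funext S
      simp only [hu, Finset.forall_mem_insert]
      by_cases h1 : s ∈ S.1 <;> by_cases h2 : (∀ t ∈ A, t ∈ S.1 ↔ t ∈ S₀.1) <;> simp [h1, h2, hs0]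
    · convert hπ' using 1
      funext S
      simp only [hu, Finset.forall_mem_insert]
      by_cases h1 : s ∈ S.1 <;> by_cases h2 : (∀ t ∈ A, t ∈ S.1 ↔ t ∈ S₀.1) <;> simp [h1, h2, hs0]

end Torus

/-! ## 3. Hall's count for the inclusion graph and the dimension of `𝒳 · (coordinate subspace)` -/

section Hall

variable {K : Type*} [Field K] {n p : ℕ}

/-- **Hall's condition for the `(p, p+1)`-inclusion graph on `[2p+1]`**: a family `𝒮` of
`p`-subsets has an upper shadow `∇𝒮 = {T : |T| = p+1, ∃ S ∈ 𝒮, S ⊆ T}` with `|∇𝒮| ≥ |𝒮|` (the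
bipartite inclusion graph is `(p+1)`-regular on both sides when `n = 2p+1`; double counting).
[cite: DerksenMakam2018, Cor 4.7, p. 9] locator: paper:arxiv-1606.06701 p0009.txt:L75 -/
theorem card_le_card_upperShadow (hn : n = 2 * p + 1) (𝒮 : Finset (ExtIdx n p)) :
    𝒮.card ≤ (Finset.univ.filter fun T : ExtIdx n (p + 1) => ∃ S ∈ 𝒮, S.1 ⊆ T.1).card := by
  classical
  set t : Finset (ExtIdx n (p + 1)) := Finset.univ.filter fun T : ExtIdx n (p + 1) => ∃ S ∈ 𝒮, S.1 ⊆ T.1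
  have key := Finset.card_mul_le_card_mul (fun (S : ExtIdx n p) (T : ExtIdx n (p + 1)) => S.1 ⊆ T.1)
    (s := 𝒮) (t := t) (m := p + 1) (n := p + 1) ?_ ?_
  · exact Nat.le_of_mul_le_mul_right key (Nat.succ_pos p)
  · -- every `S ∈ 𝒮` has `p + 1 = n - p` supersets `insert i S`, all in `t`
    intro S hS
    have hcompl : (S.1ᶜ).card = p + 1 := by
      rw [Finset.card_compl, S.2, Fintype.card_fin, hn]
      omega
    have hinj : Set.InjOn (fun i : Fin n => insert i S.1) (S.1ᶜ : Finset (Fin n)) := by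
      intro i hi j hj hij
      exact (Finset.insert_inj (Finset.mem_compl.1 (Finset.mem_coe.1 hi))).1 hij
    have hsub : (S.1ᶜ).image (fun i : Fin n => insert i S.1) ⊆
        (t.bipartiteAbove (fun (S : ExtIdx n p) (T : ExtIdx n (p + 1)) => S.1 ⊆ T.1) S).image
          Subtype.val := by
      intro U hU
      obtain ⟨i, hi, rfl⟩ := Finset.mem_image.1 hU
      have hi' : i ∉ S.1 := Finset.mem_compl.1 hi
      have hcard : (insert i S.1).card = p + 1 := by rw [Finset.card_insert_of_notMem hi', S.2]
      refine Finset.mem_image.2 ⟨⟨insert i S.1, hcard⟩, ?_, rfl⟩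
      refine (Finset.mem_bipartiteAbove _).2 ⟨?_, Finset.subset_insert _ _⟩
      exact Finset.mem_filter.2 ⟨Finset.mem_univ _, S, hS, Finset.subset_insert _ _⟩
    calc p + 1 = ((S.1ᶜ).image (fun i : Fin n => insert i S.1)).card := by
          rw [Finset.card_image_of_injOn hinj, hcompl]
      _ ≤ _ := Finset.card_le_card hsub
      _ = _ := Finset.card_image_of_injective _ Subtype.val_injective
  · -- every `T` has at most `C(p+1, p) = p + 1` subsets of size `p`
    intro T hT
    have hsub : (𝒮.bipartiteBelow (fun (S : ExtIdx n p) (T : ExtIdx n (p + 1)) => S.1 ⊆ T.1) T).image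
        Subtype.val ⊆ T.1.powersetCard p := by
      intro U hU
      obtain ⟨S, hS, rfl⟩ := Finset.mem_image.1 hU
      exact Finset.mem_powersetCard.2 ⟨((Finset.mem_bipartiteBelow _).1 hS).2, S.2⟩
    calc _ = ((𝒮.bipartiteBelow (fun (S : ExtIdx n p) (T : ExtIdx n (p + 1)) => S.1 ⊆ T.1) T).image
          Subtype.val).card := (Finset.card_image_of_injective _ Subtype.val_injective).symm
      _ ≤ (T.1.powersetCard p).card := Finset.card_le_card hsub
      _ = p + 1 := by rw [Finset.card_powersetCard, T.2, Nat.choose_succ_self_right]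

/-- `L_{e_i} e_S = ± e_T` when `T = S ∪ {i}`. [cite: DerksenMakam2018, §4, p. 9] locator: paper:arxiv-1606.06701 p0009.txt:L5 -/
theorem extMulMatrix_mulVec_single (i : Fin n) (S : ExtIdx n p) (T : ExtIdx n (p + 1))
    (hT : T.1 = insert i S.1) :
    (extMulMatrix K n p i).mulVec (Pi.single S 1) = wedgeSign K i S.1 • Pi.single T (1 : K) := by
  classical
  rw [Matrix.mulVec_single_one]
  funext T'
  change extMulMatrix K n p i T' S = _
  rw [extMulMatrix, Matrix.of_apply, Pi.smul_apply, smul_eq_mul, ← hT]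
  by_cases h : T' = T
  · subst h
    simp
  · rw [if_neg (fun h' => h (Subtype.ext h')), Pi.single_eq_of_ne h, mul_zero]

/-- **No shrinkage on coordinate subspaces**: if `W ≤ Λ^p K^{2p+1}` contains the coordinate
components of its vectors, then `dim 𝒳(p,2p+1)·W ≥ dim W` (`W ⊆ span{e_S : S ∈ 𝒮}`,
`𝒳·W ⊇ {e_T : T ∈ ∇𝒮}`, and `|∇𝒮| ≥ |𝒮|`). [cite: DerksenMakam2018, Cor 4.7, p. 9] locator: paper:arxiv-1606.06701 p0009.txt:L75 -/
theorem finrank_le_finrank_imageSubspace_of_coord (hn : n = 2 * p + 1)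
    {W : Submodule K (ExtIdx n p → K)} (hW : ∀ w ∈ W, ∀ S, Pi.single S (w S) ∈ W) :
    Module.finrank K W ≤ Module.finrank K (imageSubspace (Set.range (extMulMatrix K n p)) W) := by
  classical
  let 𝒮 : Finset (ExtIdx n p) :=
    Finset.univ.filter fun S => (Pi.single S (1 : K) : ExtIdx n p → K) ∈ W
  let t : Finset (ExtIdx n (p + 1)) := Finset.univ.filter fun T => ∃ S ∈ 𝒮, S.1 ⊆ T.1
  -- (a) `dim W ≤ |𝒮|`
  have ha : Module.finrank K W ≤ 𝒮.card := by
    have hle : W ≤ Submodule.span K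
        (Set.range fun S : 𝒮 => (Pi.single S.1 (1 : K) : ExtIdx n p → K)) := by
      intro w hw
      rw [← Finset.univ_sum_single w]
      refine Submodule.sum_mem _ fun S _ => ?_
      by_cases h0 : w S = 0
      · rw [h0, Pi.single_zero]
        exact Submodule.zero_mem _
      · have hS : S ∈ 𝒮 := by
          refine Finset.mem_filter.2 ⟨Finset.mem_univ _, ?_⟩
          have := W.smul_mem (w S)⁻¹ (hW w hw S)
          rwa [← Pi.single_smul', smul_eq_mul, inv_mul_cancel₀ h0] at this
        have : Pi.single S (w S) = w S • (Pi.single S (1 : K) : ExtIdx n p → K) := by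
          rw [← Pi.single_smul', smul_eq_mul, mul_one]
        rw [this]
        exact Submodule.smul_mem _ _ (Submodule.subset_span ⟨⟨S, hS⟩, rfl⟩)
    exact (Submodule.finrank_mono hle).trans ((finrank_range_le_card _).trans (by simp))
  -- (b) `|∇𝒮| ≤ dim 𝒳·W`
  have hb : t.card ≤ Module.finrank K (imageSubspace (Set.range (extMulMatrix K n p)) W) := by
    have hmem : ∀ T ∈ t, (Pi.single T (1 : K) : ExtIdx n (p + 1) → K) ∈
        imageSubspace (Set.range (extMulMatrix K n p)) W := by
      intro T hT
      obtain ⟨S, hS, hST⟩ := (Finset.mem_filter.1 hT).2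
      have hSW : (Pi.single S (1 : K) : ExtIdx n p → K) ∈ W := (Finset.mem_filter.1 hS).2
      obtain ⟨i, hi⟩ : (T.1 \ S.1).Nonempty := by
        rw [← Finset.card_pos, Finset.card_sdiff_of_subset hST, T.2, S.2]
        omega
      have hiT : i ∈ T.1 := (Finset.mem_sdiff.1 hi).1
      have hiS : i ∉ S.1 := (Finset.mem_sdiff.1 hi).2
      have hTi : T.1 = insert i S.1 := by
        refine (Finset.eq_of_subset_of_card_le (Finset.insert_subset hiT hST) ?_).symm
        rw [Finset.card_insert_of_notMem hiS, S.2, T.2]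
      have h := map_mulVecLin_le_imageSubspace (𝓑 := Set.range (extMulMatrix K n p))
        (B := extMulMatrix K n p i) ⟨i, rfl⟩ W ⟨_, hSW, rfl⟩
      rw [Matrix.mulVecLin_apply, extMulMatrix_mulVec_single i S T hTi] at h
      have h' := Submodule.smul_mem _ (wedgeSign K i S.1) h
      rwa [smul_smul, wedgeSign_mul_self, one_smul] at h'
    have hli : LinearIndependent K fun T : t =>
        (⟨Pi.single T.1 (1 : K), hmem T.1 T.2⟩ : imageSubspace (Set.range (extMulMatrix K n p)) W) := by
      apply LinearIndependent.of_comp (Submodule.subtype _)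
      have : (Submodule.subtype _) ∘ (fun T : t =>
          (⟨Pi.single T.1 (1 : K), hmem T.1 T.2⟩ : imageSubspace (Set.range (extMulMatrix K n p)) W)) =
          (Pi.basisFun K (ExtIdx n (p + 1))) ∘ (fun T : t => T.1) := by
        funext T
        simp [Pi.basisFun_apply]
      rw [this]
      exact (Pi.basisFun K (ExtIdx n (p + 1))).linearIndependent.comp _ Subtype.val_injective
    have := hli.fintype_card_le_finrank
    rwa [Fintype.card_coe] at this
  exact ha.trans ((card_le_card_upperShadow hn 𝒮).trans hb)

end Hall

/-! ## 4. Full non-commutative rank of `𝒳(p, 2p+1)` and the discharges -/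

section Full

variable {K : Type*} [Field K]

/-- **`ncrk{L_{e_i}} = C(2p+1, p)` over every field with an element `a ∉ {0,1}`** (greatest optimal
shrunk subspace is torus-stable, hence coordinate, hence non-shrinking by Hall).
[cite: DerksenMakam2018, Cor 4.7, p. 9] locator: paper:arxiv-1606.06701 p0009.txt:L75 -/
theorem ncRank_range_extMulMatrix_eq_choose (p : ℕ) (ha : ∃ a : K, a ≠ 0 ∧ a ≠ 1) :
    ncRank (Set.range (extMulMatrix K (2 * p + 1) p)) = (2 * p + 1).choose p := by
  classical
  obtain ⟨a, ha0, ha1⟩ := ha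
  refine le_antisymm ((ncRank_le_card_cols _).trans (card_extIdx _ _).le) ?_
  obtain ⟨V, hV, hmax⟩ := exists_greatest_optimal (Set.range (extMulMatrix K (2 * p + 1) p))
  have hstab : ∀ (s : Fin (2 * p + 1)), ∀ w ∈ V,
      (Matrix.diagonal fun S : ExtIdx (2 * p + 1) p => if s ∈ S.1 then a else (1 : K)).mulVec w ∈ V := by
    intro s w hw
    have hle := map_le_of_greatest_optimal hV hmax
      (Matrix.diagonal fun S : ExtIdx (2 * p + 1) p => if s ∈ S.1 then a else (1 : K)).mulVecLin
      (mulVecLin_diagonal_injective fun S => by split_ifs <;> simp [ha0])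
      (Matrix.diagonal fun T : ExtIdx (2 * p + 1) (p + 1) => if s ∈ T.1 then a else (1 : K)).mulVecLin
      (mulVecLin_diagonal_injective fun T => by split_ifs <;> simp [ha0])
      (imageSubspace_map_scale_le s ha0 V)
    exact hle ⟨w, hw, rfl⟩
  have hcoord : ∀ w ∈ V, ∀ S, Pi.single S (w S) ∈ V :=
    fun w hw S => single_apply_mem_of_scale_stable ha1 hstab hw S
  have hdim := finrank_le_finrank_imageSubspace_of_coord rfl hcoord
  rw [← hV, shrunkCost]
  have hq := Submodule.finrank_quotient_add_finrank V
  rw [Module.finrank_fintype_fun_eq_card, card_extIdx] at hq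
  omega

/-- **[DM16, Corollary 4.7] for `𝒳(p,2p+1)`, PROVED over every field `≠ 𝔽₂`**:
`ncrk 𝒳(p, 2p+1) = C(2p+1, p)`. [cite: DerksenMakam2018, Cor 4.7, p. 9] locator: paper:arxiv-1606.06701 p0009.txt:L75 -/
theorem ncRank_dmSpace_eq_choose (p : ℕ) (ha : ∃ a : K, a ≠ 0 ∧ a ≠ 1) :
    ncRank (dmSpace K (2 * p + 1) p : Set (Matrix (ExtIdx (2 * p + 1) (p + 1))
      (ExtIdx (2 * p + 1) p) K)) = (2 * p + 1).choose p := by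
  rw [ncRank_dmSpace]
  exact ncRank_range_extMulMatrix_eq_choose p ha

/-- **[DM16, Corollary 4.7], PROVED unconditionally in characteristic `0`** (the setting of
[DM16, §4]); compare `DerksenMakam2018_cor_4_7_of_prop_4_6` (the printed route through Landsberg).
[cite: DerksenMakam2018, Cor 4.7, p. 9] locator: paper:arxiv-1606.06701 p0009.txt:L75 -/
theorem DerksenMakam2018_cor_4_7 [CharZero K] (p : ℕ) :
    ncRank (dmSpace K (2 * p + 1) p : Set (Matrix (ExtIdx (2 * p + 1) (p + 1))
      (ExtIdx (2 * p + 1) p) K)) = (2 * p + 1).choose p :=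
  ncRank_dmSpace_eq_choose p ⟨2, two_ne_zero, by norm_num⟩

/-- **DISCHARGE of [DM16, Theorem 1.15]**: `ncrk 𝒳(p,2p+1) / rk 𝒳(p,2p+1) = (2p+1)/(p+1)` for every `p`
over every field of characteristic `0`. [cite: DerksenMakam2018, Thm 1.15, p. 4] locator: paper:arxiv-1606.06701 p0004.txt:L42 -/
theorem DerksenMakam2018_thm_1_15_holds :
    ∀ (K : Type*) [Field K] [CharZero K] (p : ℕ), DerksenMakam2018_thm_1_15 K p :=
  fun _ _ _ p => (DerksenMakam2018_thm_1_15_iff p).2 (DerksenMakam2018_cor_4_7 p)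

/-- `hrk` of the relabelled linear matrix `A(p,2p+1)` is `C(2p+1,p)` over every field `≠ 𝔽₂`.
[cite: EfremenkoGargOliveiraWigderson2018, §6, p. 17] locator: paper:arxiv-1710.09502 p0017.txt:L20 -/
theorem homogRank_genericCombination_dmSquareFamily_eq {F : Type*} [Field F] (p : ℕ)
    (ha : ∃ a : F, a ≠ 0 ∧ a ≠ 1) :
    homogRank (genericCombination (dmSquareFamily F p)) = (2 * p + 1).choose p := by
  rw [homogRank_genericCombination_eq_ncRank, ncRank_range_dmSquareFamily]
  exact ncRank_dmSpace_eq_choose p ha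

/-- **[EGOW18, §6 bullet 4], PROVED** over every field with an element `∉ {0,1}` (every field except
`𝔽₂`): for every `ε > 0` a linear matrix with `0 < rk` and `hrk ≥ (2 − ε) · rk`.
[cite: EfremenkoGargOliveiraWigderson2018, §6, p. 17] locator: paper:arxiv-1710.09502 p0017.txt:L20 -/
theorem EGOW2018_sec6_derksenMakam_of_exists_ne {F : Type*} [Field F] (ha : ∃ a : F, a ≠ 0 ∧ a ≠ 1) :
    EGOW2018_sec6_derksenMakam F := by
  intro ε hε
  obtain ⟨p, hp⟩ := exists_nat_gt (1 / ε)
  have hpε : 1 / ((p : ℝ) + 1) < ε := by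
    rw [div_lt_iff₀ (by positivity)]
    rw [div_lt_iff₀ hε] at hp
    nlinarith
  refine ⟨2 * p + 1, (2 * p + 1).choose p, (2 * p).choose p, genericCombination (dmSquareFamily F p),
    isHomogeneous_genericCombination _, symbolicRank_genericCombination_dmSquareFamily p,
    Nat.choose_pos (by omega), ?_⟩
  rw [homogRank_genericCombination_dmSquareFamily_eq p ha]
  exact (two_sub_eps_mul_choose_lt hpε).le

/-- **[EGOW18, §6 bullet 4] in characteristic `0` (the source's setting), PROVED — the named statement
`EGOW2018_sec6_derksenMakam` holds for every field of characteristic `0`.**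
[cite: EfremenkoGargOliveiraWigderson2018, §6, p. 17] locator: paper:arxiv-1710.09502 p0017.txt:L20 -/
theorem EGOW2018_sec6_derksenMakam_of_charZero (F : Type*) [Field F] [CharZero F] :
    EGOW2018_sec6_derksenMakam F :=
  EGOW2018_sec6_derksenMakam_of_exists_ne ⟨2, two_ne_zero, by norm_num⟩

/-- **[EGOW18, Conjecture 6.1] HOLDS AT `d = 1`, unconditionally, over every field with an element
`∉ {0,1}`**: for every real `ε > 0` there is a square matrix `M(x)` of linear forms with
`hrk(M) > (1 + 1 − ε) · rk_{F(x)}(M)` — clause for clause the `d = 1` instance of the Summits leaf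
`EGOW2018_conj61Over F` (not imported; a prover closes that instance by this theorem).
[cite: EfremenkoGargOliveiraWigderson2018, Conj 6.1, p. 17] locator: paper:arxiv-1710.09502 p0017.txt:L27 -/
theorem EGOW2018_conj61_degOne_of_exists_ne {F : Type*} [Field F] (ha : ∃ a : F, a ≠ 0 ∧ a ≠ 1)
    (ε : ℝ) (hε : 0 < ε) :
    ∃ (n m r : ℕ) (M : Matrix (Fin m) (Fin m) (MvPolynomial (Fin n) F)),
      (∀ i j, (M i j).IsHomogeneous 1) ∧ symbolicRank M = r ∧
        (((1 : ℕ) : ℝ) + 1 - ε) * r < (homogRank M : ℝ) := by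
  obtain ⟨p, hp⟩ := exists_nat_gt (1 / ε)
  have hpε : 1 / ((p : ℝ) + 1) < ε := by
    rw [div_lt_iff₀ (by positivity)]
    rw [div_lt_iff₀ hε] at hp
    nlinarith
  refine ⟨2 * p + 1, (2 * p + 1).choose p, (2 * p).choose p, genericCombination (dmSquareFamily F p),
    isHomogeneous_genericCombination _, symbolicRank_genericCombination_dmSquareFamily p, ?_⟩
  rw [homogRank_genericCombination_dmSquareFamily_eq p ha]
  have : ((1 : ℕ) : ℝ) + 1 - ε = 2 - ε := by norm_num
  rw [this]
  exact two_sub_eps_mul_choose_lt hpε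

/-- **[EGOW18, Conjecture 6.1] HOLDS AT `d = 1` over every field of characteristic `0`** (the paper's
setting), unconditionally. [cite: EfremenkoGargOliveiraWigderson2018, Conj 6.1, p. 17] locator: paper:arxiv-1710.09502 p0017.txt:L27 -/
theorem EGOW2018_conj61_degOne (F : Type*) [Field F] [CharZero F] (ε : ℝ) (hε : 0 < ε) :
    ∃ (n m r : ℕ) (M : Matrix (Fin m) (Fin m) (MvPolynomial (Fin n) F)),
      (∀ i j, (M i j).IsHomogeneous 1) ∧ symbolicRank M = r ∧
        (((1 : ℕ) : ℝ) + 1 - ε) * r < (homogRank M : ℝ) :=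
  EGOW2018_conj61_degOne_of_exists_ne ⟨2, two_ne_zero, by norm_num⟩ ε hε

end Full

end Literature.Computability.AlgebraicComplexity
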